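import Summits.Ventures.CertifiedManyBodySolver.Observables.PairLROTowerChargedOpNorm
import HarnessLib

/-!
# OP1-C, part 17: the eom word as a combination of LADDER WORDS — evenness, adjoint, charge (node-file inputs)

HONEST FRAMING: first certified bounds on pairing observables; not a superconductivity verdict; a ceiling route,
never presence; nothing in this file is a number. Crew hubbard-obs (D-0042), seat hubbard-obs-p1
(`prover-hubbard-obs-p1-g9-0`). Zero compute; no definition; no named fact; no `sorry`.

A Stage-B node file writes the charged eom word as `X = Σ_i c_i • ladderWord (l i)` (normal-ordered monomials of
the certificate's generators with their multipliers). The OP1-C readers ask for `X, Xᴴ ∈ carEvenSubalgebra univ`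
and `‖N̂₀X − XN̂₀‖ ≤ C_q`. This file discharges the first two generically and records the charge identity:

* `ladderWord_append`, `conjTranspose_ladderLetter`, `conjTranspose_ladderWord` — `(a₁⋯a_k)ᴴ = a_kᴴ⋯a₁ᴴ` is the
  ladder word of the reversed, dagger-flipped list;
* `ladderWord_mem_carEvenSubalgebra_of_even_length` — an EVEN-length ladder word is an even operator;
* `sum_smul_ladderWord_mem_carEvenSubalgebra`, `conjTranspose_sum_smul_ladderWord_mem_carEvenSubalgebra` — hence
  `X` and `Xᴴ` for any combination of even-length words (`hXeven` / `hXevenH` of the readers);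
* `totalNumberOp_commutator_sum_smul_ladderWord` — `N̂₀X − XN̂₀ = Σ_i (c_i·q(l i)) • ladderWord (l i)`,
  `q = #creators − #annihilators` (the word whose one-point nodes the TIGHT form would use; the operator-norm bound
  is `norm_totalNumberOp_commutator_sum_smul_ladderWord_le`, PairLROTowerChargedOpNorm).

References: O. Bratteli, D. W. Robinson, *Operator Algebras and Quantum Statistical Mechanics 2* (1997) §5.2.2
[BratteliRobinsonII1997]; D. E. Evans, Y. Kawahigashi, *Quantum Symmetries on Operator Algebras* (1998) §6.5
[EvansKawahigashi1998].
-/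

noncomputable section

namespace Summit.Ventures.CertifiedManyBodySolver.Observables

open Matrix Complex Finset Literature.MathematicalPhysics.QuantumLattice
open scoped ComplexOrder ComplexConjugate BigOperators

section LadderWords

variable {ι : Type*} [LinearOrder ι] [Fintype ι]

/-- `ladderWord (l₁ ++ l₂) = ladderWord l₁ * ladderWord l₂`. [folklore] -/
theorem ladderWord_append (l₁ l₂ : List (ι × Bool)) :
    (ladderWord (l₁ ++ l₂) : Matrix (Finset ι) (Finset ι) ℂ) = ladderWord l₁ * ladderWord l₂ := by
  induction l₁ with
  | nil => simp
  | cons p t ih => rw [List.cons_append, ladderWord_cons, ladderWord_cons, ih, Matrix.mul_assoc]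

omit [Fintype ι] in
/-- `(c†_i)ᴴ = c_i`, `(c_i)ᴴ = c†_i`: the adjoint of a letter is the dagger-flipped letter. [cite: BratteliRobinsonII1997, §5.2.2] -/
theorem conjTranspose_ladderLetter (p : ι × Bool) :
    (ladderLetter p : Matrix (Finset ι) (Finset ι) ℂ)ᴴ = ladderLetter (p.1, !p.2) := by
  obtain ⟨i, b⟩ := p
  cases b
  · simp [ladderLetter, annihilation_conjTranspose]
  · simp [ladderLetter, creation_conjTranspose]

/-- **The adjoint of a ladder word** is the ladder word of the reversed, dagger-flipped list:
`(a₁⋯a_k)ᴴ = a_kᴴ⋯a₁ᴴ`. [cite: BratteliRobinsonII1997, §5.2.2] -/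
theorem conjTranspose_ladderWord (l : List (ι × Bool)) :
    (ladderWord l : Matrix (Finset ι) (Finset ι) ℂ)ᴴ = ladderWord (l.reverse.map fun p => (p.1, !p.2)) := by
  induction l with
  | nil => simp
  | cons p t ih =>
    rw [ladderWord_cons, conjTranspose_mul, ih, conjTranspose_ladderLetter, List.reverse_cons, List.map_append,
      ladderWord_append]
    simp

/-- **An even-length ladder word is an even operator** (a product of pairs of letters, each pair a generator of the
even CAR subalgebra). [cite: EvansKawahigashi1998, §6.5] -/
theorem ladderWord_mem_carEvenSubalgebra_of_even_length :
    ∀ {l : List (ι × Bool)}, Even l.length →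
      (ladderWord l : Matrix (Finset ι) (Finset ι) ℂ) ∈ carEvenSubalgebra (Finset.univ : Finset ι)
  | [], _ => by rw [ladderWord_nil]; exact Subalgebra.one_mem _
  | [p], h => by simp at h
  | p :: q :: t, h => by
    have ht : Even t.length := by
      simp only [List.length_cons] at h
      rcases h with ⟨k, hk⟩
      exact ⟨k - 1, by omega⟩
    rw [ladderWord_cons, ladderWord_cons, ← Matrix.mul_assoc]
    refine Subalgebra.mul_mem _ ?_ (ladderWord_mem_carEvenSubalgebra_of_even_length ht)
    exact Algebra.subset_adjoin ⟨p, q, Finset.mem_univ _, Finset.mem_univ _, rfl⟩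

/-- **`X = Σ_i c_i • ladderWord (l i)` is even** when every `l i` has even length (`hXeven` of the OP1-C readers).
[cite: EvansKawahigashi1998, §6.5] -/
theorem sum_smul_ladderWord_mem_carEvenSubalgebra {κ : Type*} (s : Finset κ) (c : κ → ℂ) (l : κ → List (ι × Bool))
    (hl : ∀ i ∈ s, Even (l i).length) :
    (∑ i ∈ s, c i • (ladderWord (l i) : Matrix (Finset ι) (Finset ι) ℂ)) ∈ carEvenSubalgebra (Finset.univ : Finset ι) :=
  Subalgebra.sum_mem _ fun i hi => Subalgebra.smul_mem _ (ladderWord_mem_carEvenSubalgebra_of_even_length (hl i hi)) _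

/-- **`Xᴴ` is even** for `X = Σ_i c_i • ladderWord (l i)` with even-length words (`hXevenH` of the OP1-C readers).
[cite: EvansKawahigashi1998, §6.5] -/
theorem conjTranspose_sum_smul_ladderWord_mem_carEvenSubalgebra {κ : Type*} (s : Finset κ) (c : κ → ℂ)
    (l : κ → List (ι × Bool)) (hl : ∀ i ∈ s, Even (l i).length) :
    (∑ i ∈ s, c i • (ladderWord (l i) : Matrix (Finset ι) (Finset ι) ℂ))ᴴ ∈ carEvenSubalgebra (Finset.univ : Finset ι) := by
  rw [conjTranspose_sum]
  refine Subalgebra.sum_mem _ fun i hi => ?_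
  rw [conjTranspose_smul, conjTranspose_ladderWord]
  refine Subalgebra.smul_mem _ (ladderWord_mem_carEvenSubalgebra_of_even_length ?_) _
  simpa using hl i hi

/-- **The charge of a combination of ladder words**: `N̂₀X − XN̂₀ = Σ_i (c_i·q(l i)) • ladderWord (l i)` for
`X = Σ_i c_i • ladderWord (l i)`, `q = #creators − #annihilators`. [cite: BratteliRobinsonII1997, §5.2.2] -/
theorem totalNumberOp_commutator_sum_smul_ladderWord {κ : Type*} (s : Finset κ) (c : κ → ℂ)
    (l : κ → List (ι × Bool)) :
    totalNumberOp * (∑ i ∈ s, c i • (ladderWord (l i) : Matrix (Finset ι) (Finset ι) ℂ)) -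
        (∑ i ∈ s, c i • (ladderWord (l i) : Matrix (Finset ι) (Finset ι) ℂ)) * totalNumberOp =
      ∑ i ∈ s, (c i * ((ladderCharge (l i) : ℤ) : ℂ)) • (ladderWord (l i) : Matrix (Finset ι) (Finset ι) ℂ) := by
  rw [Finset.mul_sum, Finset.sum_mul, ← Finset.sum_sub_distrib]
  refine Finset.sum_congr rfl fun i _ => ?_
  rw [Matrix.mul_smul, Matrix.smul_mul, ← smul_sub, totalNumberOp_commutator_ladderWord, smul_smul]

end LadderWords

end Summit.Ventures.CertifiedManyBodySolver.Observables

end
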